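import Literature.MathematicalPhysics.KineticTheory.EvenStatTruncationBound
import Literature.MathematicalPhysics.KineticTheory.HardSphereEulerProofs
import HarnessLib

/-!
# The energy tail (H_E) of S1 at time zero, for general profiles
# (`stub_velocityTailEnergyTimeZero`, line `even-rung-mean-variance`, crux `JParityClosure.EvenStressEnskog`,
# stmt-AtomisticToContinuum-13079)

The second antecedent (H_E) of `stub_velocityTruncationOfTails` asks that the fixed-time means of the
tail kinetic energy per particle `T_L = tailEnergy L` (`CollisionTailMarks`) under the evolved local
Gibbs law be small uniformly on `[0, τ]`.  At TIME ZERO it holds for general continuous profiles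
`a₀, θ₀ > 0`, `u₀`: conditionally on the positions the velocities are independent Gaussians
`N(u₀(xᵢ), θ₀(xᵢ) id)` (`lintegral_localGibbsMeasure`), whose tails are dominated, uniformly in the
position, by `domGaussTail U Θ L` with `U = max ‖u₀‖`, `Θ = max θ₀` (`gaussVelTail_le_domGaussTail`,
`tendsto_domGaussTail`); hence `∫ T_L dLG_N ≤ domGaussTail U Θ L → 0`
(`lintegral_tailEnergy_localGibbsMeasure_le`), and `Φ_0 = id` on the good set, which carries the law
(`lintegral_tailEnergy_flow_zero_le`).  The open part of (H_E) is thus purely dynamical: propagation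
of this bound to positive times along the deterministic flow.  The registered helper stub
`stub_velocityTailEnergyTimeZero` is the `∀`-form.

References: H. Spohn, *Large Scale Dynamics of Interacting Particles* (1991), Part I §2.3 (local
equilibrium states).
-/

noncomputable section

open MeasureTheory Set Filter Topology
open scoped ENNReal InnerProductSpace BigOperators

namespace Summit.AtomisticToContinuum.HydrodynamicLimit.Theorems.EvenStressEnskog

open Literature.Analysis.FluidPDE Literature.MathematicalPhysics.KineticTheory

/-! ## The energy tail of the local Gibbs law -/

/-- **The energy tail of the local Gibbs law itself is a uniform Gaussian tail.**  For continuous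
profiles `a₀ ≥ 0`, `θ₀ > 0`, `u₀` with `‖u₀‖ ≤ U`, `θ₀ ≤ Θ`, when the local Gibbs measure is a probability
measure: `∫ T_L dLG_N ≤ G(U, Θ, L)` for every `N` and `L` (disintegration into positions and
independent Gaussian velocities, `lintegral_localGibbsMeasure`). [folklore] -/
theorem lintegral_tailEnergy_localGibbsMeasure_le {a₀ θ₀ : T3 → ℝ} {u₀ : T3 → V3} (ha : Continuous a₀)
    (hθ : Continuous θ₀) (hu : Continuous u₀) (ha0 : ∀ x, 0 ≤ a₀ x) (hθ0 : ∀ x, 0 < θ₀ x) {U Θ : ℝ}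
    (hU : ∀ x, ‖u₀ x‖ ≤ U) (hΘ : ∀ x, θ₀ x ≤ Θ) (σ : ℝ) (N : ℕ)
    [IsProbabilityMeasure (localGibbsMeasure σ a₀ u₀ θ₀ N)] (L : ℝ) :
    ∫⁻ z, ENNReal.ofReal (tailEnergy L z) ∂localGibbsMeasure σ a₀ u₀ θ₀ N ≤ domGaussTail U Θ L := by
  have hmeas : Measurable fun z : Config (N + 1) (Fin 3) T3 => ENNReal.ofReal (tailEnergy L z) :=
    (measurable_tailEnergy L).ennreal_ofReal
  rw [lintegral_localGibbsMeasure ha hθ hu ha0 hθ0 σ N hmeas]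
  have hn0 : ((N + 1 : ℕ) : ℝ≥0∞) ≠ 0 := by exact_mod_cast Nat.succ_ne_zero N
  have hnt : ((N + 1 : ℕ) : ℝ≥0∞) ≠ ∞ := ENNReal.natCast_ne_top _
  have hinner : ∀ x : Fin (N + 1) → T3,
      ∫⁻ v, ENNReal.ofReal (tailEnergy L (zipConfig (x, v))) ∂velMeasure u₀ θ₀ x ≤ domGaussTail U Θ L := by
    intro x
    have hpt : ∀ v : Fin (N + 1) → V3, ENNReal.ofReal (tailEnergy L (zipConfig (x, v))) =
        ((N + 1 : ℕ) : ℝ≥0∞)⁻¹ * ∑ i, ENNReal.ofReal (velTail L (v i)) := by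
      intro v
      unfold tailEnergy
      simp only [zipConfig_apply]
      rw [ENNReal.ofReal_mul (inv_nonneg.2 (Nat.cast_nonneg _)),
        ENNReal.ofReal_inv_of_pos (by exact_mod_cast Nat.succ_pos N), ENNReal.ofReal_natCast,
        ENNReal.ofReal_sum_of_nonneg fun i _ => velTail_nonneg L _]
    simp_rw [hpt]
    have hmi : ∀ i : Fin (N + 1), Measurable fun v : Fin (N + 1) → V3 => ENNReal.ofReal (velTail L (v i)) :=
      fun i => ((measurable_velTail L).comp (measurable_pi_apply i)).ennreal_ofReal
    rw [lintegral_const_mul _ (Finset.measurable_sum _ fun i _ => hmi i),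
      lintegral_finsetSum _ fun i _ => hmi i]
    have hterm : ∀ i : Fin (N + 1),
        ∫⁻ v, ENNReal.ofReal (velTail L (v i)) ∂velMeasure u₀ θ₀ x ≤ domGaussTail U Θ L := by
      intro i
      unfold velMeasure
      rw [(measurePreserving_eval (fun j : Fin (N + 1) => gaussMeasure (u₀ (x j)) (θ₀ (x j))) i).lintegral_comp
        (measurable_velTail L).ennreal_ofReal]
      exact gaussVelTail_le_domGaussTail (hU _) (hΘ _) L
    calc ((N + 1 : ℕ) : ℝ≥0∞)⁻¹ * ∑ i, ∫⁻ v, ENNReal.ofReal (velTail L (v i)) ∂velMeasure u₀ θ₀ x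
        ≤ ((N + 1 : ℕ) : ℝ≥0∞)⁻¹ * ∑ _i : Fin (N + 1), domGaussTail U Θ L := by
          gcongr with i
          exact hterm i
      _ = domGaussTail U Θ L := by
          rw [Finset.sum_const, Finset.card_univ, Fintype.card_fin, nsmul_eq_mul, ← mul_assoc,
            ENNReal.inv_mul_cancel hn0 hnt, one_mul]
  have hρm : Measurable fun x : Fin (N + 1) → T3 => ENNReal.ofReal
      ((canonicalPartition (Torus.geometry (Fin 3)) (hsDiameter σ N) (N + 1)
        (localGibbsProfile a₀ u₀ θ₀))⁻¹ * posWeight a₀ (hsDiameter σ N) (N + 1) x) :=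
    (measurable_const.mul (measurable_posWeight ha _ _)).ennreal_ofReal
  calc ∫⁻ x, ENNReal.ofReal ((canonicalPartition (Torus.geometry (Fin 3)) (hsDiameter σ N) (N + 1)
          (localGibbsProfile a₀ u₀ θ₀))⁻¹ * posWeight a₀ (hsDiameter σ N) (N + 1) x) *
        ∫⁻ v, ENNReal.ofReal (tailEnergy L (zipConfig (x, v))) ∂velMeasure u₀ θ₀ x
      ≤ ∫⁻ x, ENNReal.ofReal ((canonicalPartition (Torus.geometry (Fin 3)) (hsDiameter σ N) (N + 1)
          (localGibbsProfile a₀ u₀ θ₀))⁻¹ * posWeight a₀ (hsDiameter σ N) (N + 1) x) * domGaussTail U Θ L :=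
        lintegral_mono fun x => mul_le_mul_right (hinner x) _
    _ = domGaussTail U Θ L := by
        rw [lintegral_mul_const _ hρm, lintegral_posWeight_eq_one ha hθ hu ha0 hθ0 σ N, one_mul]

/-- **(H_E) at time zero, for GENERAL continuous profiles**: for `a₀, θ₀ > 0`, `u₀` continuous,
`σ ≤ 1/2` and `η > 0` there is `L₀` with `∫ T_L(Φ_0 z) dLG_N(z) ≤ η` for all `L ≥ L₀`, all `N` and all
flows (`Φ_0 = id` on the good set, which carries the law).  The open part of (H_E) is
thus purely dynamical: propagation of this tail bound to positive times along the deterministic flow.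
[folklore] -/
theorem lintegral_tailEnergy_flow_zero_le {a₀ θ₀ : T3 → ℝ} {u₀ : T3 → V3} (ha : Continuous a₀)
    (hθ : Continuous θ₀) (hu : Continuous u₀) (ha0 : ∀ x, 0 < a₀ x) (hθ0 : ∀ x, 0 < θ₀ x) {σ : ℝ}
    (hσ : σ ≤ 1 / 2) {η : ℝ} (hη : 0 < η) :
    ∃ L₀ : ℝ, ∀ L : ℝ, L₀ ≤ L → ∀ (N : ℕ)
      (Φ : HardSphereFlow (Torus.geometry (Fin 3)) (hsDiameter σ N) (N + 1)),
      ∫⁻ z, ENNReal.ofReal (tailEnergy L (Φ.flow 0 z)) ∂(localGibbsLaw σ a₀ u₀ θ₀ N Φ)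
        ≤ ENNReal.ofReal η := by
  obtain ⟨U, hU⟩ := isCompact_univ.exists_bound_of_continuousOn hu.continuousOn
  obtain ⟨Θ, hΘ⟩ := isCompact_univ.exists_bound_of_continuousOn hθ.continuousOn
  have hU' : ∀ x, ‖u₀ x‖ ≤ U := fun x => hU x (mem_univ x)
  have hΘ' : ∀ x, θ₀ x ≤ Θ := fun x => by
    have := hΘ x (mem_univ x)
    rw [Real.norm_eq_abs] at this
    exact (le_abs_self _).trans this
  have hη' : (0 : ℝ≥0∞) < ENNReal.ofReal η := ENNReal.ofReal_pos.2 hη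
  obtain ⟨L₀, hL₀⟩ := eventually_atTop.1 ((tendsto_domGaussTail U Θ).eventually (gt_mem_nhds hη'))
  refine ⟨L₀, fun L hL N Φ => ?_⟩
  haveI := isProbabilityMeasure_localGibbsMeasure ha hθ hu ha0 hθ0 hσ N
  have hae : ∀ᵐ z ∂(localGibbsLaw σ a₀ u₀ θ₀ N Φ), z ∈ Φ.good := mem_ae_iff.2 (localGibbsLaw_compl_good_eq_zero Φ)
  calc ∫⁻ z, ENNReal.ofReal (tailEnergy L (Φ.flow 0 z)) ∂(localGibbsLaw σ a₀ u₀ θ₀ N Φ)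
      = ∫⁻ z, ENNReal.ofReal (tailEnergy L z) ∂(localGibbsLaw σ a₀ u₀ θ₀ N Φ) := by
        refine lintegral_congr_ae ?_
        filter_upwards [hae] with z hz
        rw [Φ.flow_zero z hz]
    _ = ∫⁻ z, ENNReal.ofReal (tailEnergy L z) ∂localGibbsMeasure σ a₀ u₀ θ₀ N := by rw [localGibbsLaw_eq]
    _ ≤ domGaussTail U Θ L :=
        lintegral_tailEnergy_localGibbsMeasure_le ha hθ hu (fun x => (ha0 x).le) hθ0 hU' hΘ' σ N L
    _ ≤ ENNReal.ofReal η := (hL₀ L hL).le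

/-! ## The registered helper stub -/

/-- **(H_E) at time zero for general profiles** (registered helper stub
`stub_velocityTailEnergyTimeZero` of the line `even-rung-mean-variance`, verbatim): for continuous
`a₀, θ₀ > 0`, `u₀`, every `σ ≤ 1/2` and `η > 0` there is `L₀` with `∫ T_L(Φ_0 z) dLG_N(z) ≤ η` for all
`L ≥ L₀`, all `N` and all flows (`lintegral_tailEnergy_flow_zero_le`). [folklore] -/
theorem stub_velocityTailEnergyTimeZero :
    ∀ (a₀ θ₀ : T3 → ℝ) (u₀ : T3 → V3), Continuous a₀ → Continuous θ₀ → Continuous u₀ → (∀ x, 0 < a₀ x) →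
      (∀ x, 0 < θ₀ x) → ∀ σ : ℝ, σ ≤ 1 / 2 → ∀ η : ℝ, 0 < η → ∃ L₀ : ℝ, ∀ L : ℝ, L₀ ≤ L →
      ∀ (N : ℕ) (Φ : HardSphereFlow (Torus.geometry (Fin 3)) (hsDiameter σ N) (N + 1)), ∫⁻ z,
      ENNReal.ofReal (tailEnergy L (Φ.flow 0 z)) ∂(localGibbsLaw σ a₀ u₀ θ₀ N Φ) ≤ ENNReal.ofReal η :=
  fun _a₀ _θ₀ _u₀ ha hθ hu ha0 hθ0 _σ hσ _η hη => lintegral_tailEnergy_flow_zero_le ha hθ hu ha0 hθ0 hσ hη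

end Summit.AtomisticToContinuum.HydrodynamicLimit.Theorems.EvenStressEnskog

end
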